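import Mathlib.Analysis.SpecialFunctions.Exp
import Mathlib.Analysis.Complex.ExponentialBounds

/-!
# Crux `UniformPhotonSphereChannels` (K1), negative side — arithmetic of the horizon estimate

Support file of the standing disprover of item stmt-FinalStateConjecture-10045.  The explicit
right-hand side of `horizon_estimate` (pinning + approximate conservation, with
`T_lo = X_l/3 ≤ X_e/3`, `T_hi − T_lo ≤ X_e/3`, `D/W_min ≤ 27X_e/8M²`, `C_χ = 40C₀/X_e`,
`E₀' = E₀/(κX_l) ≤ 5M E₀/X_e`) is dominated by
`E₀ · (75/4 (X_e/M)² + 400/9 C₀ λ + 450 C₀ (X_e/M)⁴/λ) + 240 C₀ M X_e (P + LQ)/(λL)`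
(`bound_arith`): small multiples of the data energy `E₀` once `λ` and then `X_e/M` are small,
plus a commuted-energy term that is `O(1/L)` relative to `E₀ ≥ L·G₂`. Pure real arithmetic.
[folklore]
-/

namespace Summit.FinalStateConjecture.FinalStateConjecture.Theorems

noncomputable section

namespace WaveDefect

/-- **Arithmetic of the horizon estimate.** -/
theorem bound_arith {M L Xe Xm C₀ lam E₀ P Q Tlo Thi Wmin D Cχ Ex : ℝ} (hM : 0 < M)
    (hL : 1 ≤ L) (hXe : 0 < Xe) (hXm1 : 4 / 5 * Xe ≤ Xm) (hXm2 : Xm ≤ Xe)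
    (hC₀ : 0 ≤ C₀) (hlam : 0 < lam) (hE₀ : 0 ≤ E₀) (hP : 0 ≤ P) (hQ : 0 ≤ Q)
    (hTlo : Tlo = Xm / 3) (hThi : Thi = Xe / 3) (hWmin : Wmin = L / (27 * M ^ 2))
    (hD : D = Real.exp (1 / 2) * (L * Real.exp (1 / 2) / (8 * M ^ 2)) * (4 / 3 * Xe) / (4 * M ^ 2))
    (hCχ : Cχ = C₀ / (Xe / 40)) (hEx : 1 / (4 * M) * Xm = Ex) :
    2 * (1 / (4 * M)) * (2 / 3 * Xe) *
        (Tlo * ((D / Wmin + Cχ * lam) * (2 * (E₀ / Ex))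
            + Cχ / (lam * Wmin) * (2 * (P + L * Q) + 16 * Tlo ^ 2 * D ^ 2 * (E₀ / Ex) / Wmin))
          + 4 * (D / Wmin) * (Thi - Tlo) * (2 * (E₀ / Ex)))
      ≤ E₀ * (75 / 4 * (Xe / M) ^ 2 + 400 / 9 * C₀ * lam + 450 * C₀ * (Xe / M) ^ 4 / lam)
        + 240 * C₀ * M * Xe * (P + L * Q) / (lam * L) := by
  have hL0 : 0 < L := by linarith
  have hXm0 : 0 < Xm := by linarith
  have hEx0 : 0 < Ex := by rw [← hEx]; positivity
  have hWmin0 : 0 < Wmin := by rw [hWmin]; positivity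
  have hTlo0 : 0 ≤ Tlo := by rw [hTlo]; linarith
  have hCχ' : Cχ = 40 * C₀ / Xe := by rw [hCχ]; field_simp
  have hCχ0 : 0 ≤ Cχ := by rw [hCχ']; positivity
  -- the reduced quantities and their bounds
  set δ : ℝ := D / Wmin with hδ
  set E' : ℝ := E₀ / Ex with hE'
  have hee : Real.exp (1 / 2) * Real.exp (1 / 2) ≤ 3 := by
    rw [← Real.exp_add, show (1 / 2 : ℝ) + 1 / 2 = 1 by norm_num]
    have := Real.exp_one_lt_three
    linarith
  have hD0 : 0 ≤ D := by rw [hD]; positivity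
  have hDle : D ≤ L * Xe / (8 * M ^ 4) := by
    rw [hD]
    have : Real.exp (1 / 2) * (L * Real.exp (1 / 2) / (8 * M ^ 2)) * (4 / 3 * Xe) / (4 * M ^ 2)
        = (Real.exp (1 / 2) * Real.exp (1 / 2)) * (L * Xe / (24 * M ^ 4)) := by
      field_simp; ring
    rw [this]
    have h3 : (Real.exp (1 / 2) * Real.exp (1 / 2)) * (L * Xe / (24 * M ^ 4))
        ≤ 3 * (L * Xe / (24 * M ^ 4)) := mul_le_mul_of_nonneg_right hee (by positivity)
    have : 3 * (L * Xe / (24 * M ^ 4)) = L * Xe / (8 * M ^ 4) := by field_simp; ring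
    linarith
  have hδ0 : 0 ≤ δ := by positivity
  have hδle : δ ≤ 27 * Xe / (8 * M ^ 2) := by
    rw [hδ, hWmin, div_le_iff₀ (by positivity)]
    calc D ≤ L * Xe / (8 * M ^ 4) := hDle
      _ = 27 * Xe / (8 * M ^ 2) * (L / (27 * M ^ 2)) := by field_simp
  have hE'0 : 0 ≤ E' := by positivity
  have hE'le : E' ≤ 5 * M * E₀ / Xe := by
    rw [hE', ← hEx, div_le_div_iff₀ (by positivity) hXe]
    have : E₀ * Xe ≤ E₀ * (5 / 4 * Xm) := mul_le_mul_of_nonneg_left (by linarith) hE₀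
    calc E₀ * Xe ≤ E₀ * (5 / 4 * Xm) := this
      _ = 5 * M * E₀ * (1 / (4 * M) * Xm) := by field_simp
  have hTlole : Tlo ≤ Xe / 3 := by rw [hTlo]; linarith
  have hdiff0 : 0 ≤ Thi - Tlo := by rw [hThi, hTlo]; linarith
  have hdiffle : Thi - Tlo ≤ Xe / 3 := by rw [hThi, hTlo]; linarith
  have hPLQ : 0 ≤ P + L * Q := by positivity
  -- split the left-hand side into five terms
  have hpref : 2 * (1 / (4 * M)) * (2 / 3 * Xe) = Xe / (3 * M) := by field_simp; ring
  have hsplit : Tlo * ((D / Wmin + Cχ * lam) * (2 * (E₀ / Ex))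
        + Cχ / (lam * Wmin) * (2 * (P + L * Q) + 16 * Tlo ^ 2 * D ^ 2 * (E₀ / Ex) / Wmin))
        + 4 * (D / Wmin) * (Thi - Tlo) * (2 * (E₀ / Ex))
      = Tlo * δ * (2 * E') + Tlo * Cχ * lam * (2 * E')
        + Tlo * Cχ * (2 * (P + L * Q)) / (lam * Wmin)
        + 16 * Cχ * Tlo ^ 3 * δ ^ 2 * E' / lam + 4 * δ * (Thi - Tlo) * (2 * E') := by
    simp only [hδ, hE']
    field_simp
    ring
  rw [hpref, hsplit]
  -- the five bounds
  have ha : Tlo * δ * (2 * E') ≤ Xe / 3 * (27 * Xe / (8 * M ^ 2)) * (2 * (5 * M * E₀ / Xe)) := by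
    gcongr
  have hb : Tlo * Cχ * lam * (2 * E') ≤ Xe / 3 * Cχ * lam * (2 * (5 * M * E₀ / Xe)) := by
    gcongr
  have hc : Tlo * Cχ * (2 * (P + L * Q)) / (lam * Wmin)
      ≤ Xe / 3 * Cχ * (2 * (P + L * Q)) / (lam * Wmin) := by
    gcongr
  have hd : 16 * Cχ * Tlo ^ 3 * δ ^ 2 * E' / lam
      ≤ 16 * Cχ * (Xe / 3) ^ 3 * (27 * Xe / (8 * M ^ 2)) ^ 2 * (5 * M * E₀ / Xe) / lam := by
    gcongr
  have he : 4 * δ * (Thi - Tlo) * (2 * E')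
      ≤ 4 * (27 * Xe / (8 * M ^ 2)) * (Xe / 3) * (2 * (5 * M * E₀ / Xe)) := by
    gcongr
  -- evaluate the bounds
  have ea : Xe / (3 * M) * (Xe / 3 * (27 * Xe / (8 * M ^ 2)) * (2 * (5 * M * E₀ / Xe)))
      = E₀ * (15 / 4 * (Xe / M) ^ 2) := by field_simp; ring
  have eb : Xe / (3 * M) * (Xe / 3 * Cχ * lam * (2 * (5 * M * E₀ / Xe)))
      = E₀ * (400 / 9 * C₀ * lam) := by rw [hCχ']; field_simp; ring
  have ec : Xe / (3 * M) * (Xe / 3 * Cχ * (2 * (P + L * Q)) / (lam * Wmin))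
      = 240 * C₀ * M * Xe * (P + L * Q) / (lam * L) := by rw [hCχ', hWmin]; field_simp; ring
  have ed : Xe / (3 * M) * (16 * Cχ * (Xe / 3) ^ 3 * (27 * Xe / (8 * M ^ 2)) ^ 2
        * (5 * M * E₀ / Xe) / lam) = E₀ * (450 * C₀ * (Xe / M) ^ 4 / lam) := by
    rw [hCχ']; field_simp; ring
  have ee : Xe / (3 * M) * (4 * (27 * Xe / (8 * M ^ 2)) * (Xe / 3) * (2 * (5 * M * E₀ / Xe)))
      = E₀ * (15 * (Xe / M) ^ 2) := by field_simp; ring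
  have hpref0 : 0 ≤ Xe / (3 * M) := by positivity
  have hsum := add_le_add (add_le_add (add_le_add (add_le_add ha hb) hc) hd) he
  have key := mul_le_mul_of_nonneg_left hsum hpref0
  have hexp : Xe / (3 * M) * (Xe / 3 * (27 * Xe / (8 * M ^ 2)) * (2 * (5 * M * E₀ / Xe))
        + Xe / 3 * Cχ * lam * (2 * (5 * M * E₀ / Xe))
        + Xe / 3 * Cχ * (2 * (P + L * Q)) / (lam * Wmin)
        + 16 * Cχ * (Xe / 3) ^ 3 * (27 * Xe / (8 * M ^ 2)) ^ 2 * (5 * M * E₀ / Xe) / lam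
        + 4 * (27 * Xe / (8 * M ^ 2)) * (Xe / 3) * (2 * (5 * M * E₀ / Xe)))
      = Xe / (3 * M) * (Xe / 3 * (27 * Xe / (8 * M ^ 2)) * (2 * (5 * M * E₀ / Xe)))
        + Xe / (3 * M) * (Xe / 3 * Cχ * lam * (2 * (5 * M * E₀ / Xe)))
        + Xe / (3 * M) * (Xe / 3 * Cχ * (2 * (P + L * Q)) / (lam * Wmin))
        + Xe / (3 * M) * (16 * Cχ * (Xe / 3) ^ 3 * (27 * Xe / (8 * M ^ 2)) ^ 2
          * (5 * M * E₀ / Xe) / lam)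
        + Xe / (3 * M) * (4 * (27 * Xe / (8 * M ^ 2)) * (Xe / 3) * (2 * (5 * M * E₀ / Xe))) := by
    ring
  rw [hexp, ea, eb, ec, ed, ee] at key
  linarith [key]

end WaveDefect

end

end Summit.FinalStateConjecture.FinalStateConjecture.Theorems
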